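import Literature.Analysis.FluidPDE.ParabolicScalarSolutions
import Literature.Analysis.FluidPDE.PassiveScalarBoundedExistence
import HarnessLib

/-!
# Bonicatto–Ciampa–Crippa 2024, Proposition 2.4 — DISCHARGED (existence of parabolic solutions
  of advection–diffusion equations with `L¹_t L²_x` drift)

Analysis/FluidPDE proof file (everything proved; no definitions, no new named facts). The named fact
`Literature.Analysis.FluidPDE.BonicattoCiampaCrippa2024_prop24` of `ParabolicScalarSolutions.lean` —
P. Bonicatto, G. Ciampa, G. Crippa, *Weak and parabolic solutions of advection–diffusion equations with
rough velocity field*, J. Evol. Equ. 24 (2024), Paper No. 1 = arXiv:2306.15529, **Proposition 2.4**: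
«Let `b ∈ L¹([0,T];L²(T^d))` be a divergence-free vector field and `u₀ ∈ L²(T^d)`. Then there exists at
least one parabolic solution» (of `∂ₜu + div(bu) = Δu`, `u|_{t=0} = u₀`, Def. 2.3: a distributional
solution in `L^∞_t L²_x ∩ L²_t H¹_x`) — is proved here: `BonicattoCiampaCrippa2024_prop24_holds`.

## The argument (the source's: «regularise `b` and `u₀`, energy balance (2.4), weak compactness»)

1. *Truncation of the drift in time.* With `N(t)` a measurable modification of `‖b(t)‖²_{L²}`, the
   fields `b_K = 1_{N ≤ K²} b` are square integrable on `(0,T) × T^d`, weakly divergence free at a.e.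
   time, and `∫₀ᵀ ‖b_K(t) - b(t)‖_{L²} dt = ∫_{N > K²} N^{1/2} → 0` (continuity from above of the finite
   measure `dt|_{(0,T)}` on the sets `{N > K²} ↓ {N = ∞}`, a null set, and absolute continuity of
   `A ↦ ∫_A N^{1/2}`).
2. *Regularised data* `hₙ` smooth with `‖hₙ‖_{L²} ≤ ‖θ₀‖_{L²}`, `hₙ → θ₀` in `L²`
   (`Torus.exists_isSmooth_tendsto_eLpNorm_sub`); smooth functions on the compact torus are bounded.
3. *Approximate solutions.* Along `b_K` with datum `h_K` the tree's existence theorem for `L²_{t,x}`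
   drifts and bounded data (`Torus.exists_isWeakScalarTransportOn_of_abs_le` — DiPerna–Lions 1989,
   Prop. II.1, run with the classical well-posedness and energy identity of the regularised problems)
   gives weak solutions `θ_K` with `∫ |θ_K(t)|² ≤ ‖θ₀‖²_{L²}` for a.e. `t` and
   `2 ∫₀ᵀ ‖∇θ_K‖²_{L²} ≤ ‖θ₀‖²_{L²}` — the energy balance (2.4) of the source.
4. *Weak-* compactness* in `L^∞(0,T; L²(T^d))`
   (`FunctionSpaces.Torus.exists_strictMono_weakLimit_of_lintegral_sq_le`).
5. *Identification of the limit* for an `L¹_t L²_x` limit drift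
   (`Torus.IsWeakScalarTransportOn.of_tendsto_of_lintegral_sqrt_lt_top`, this file): the weak-formulation
   integrand `∂ₜψ + b·∇ψ + Δψ` is only in `L¹(0,T; L²)`, so the weak convergence of step 4 (pairings
   against square-integrable fields) is first upgraded to pairings against `L¹_t L²_x` fields under the
   uniform `L^∞_t L²_x` bound (`Torus.tendsto_integral_mul_of_weakLimit_of_lintegral_sqrt_lt_top`:
   truncate the test field in time, uniform remainder `C^{1/2} ∫_{‖G(t)‖ > K} ‖G(t)‖_{L²}`); the
   transport error `∫∫ θ_K (b_K - b)·∇ψ` is estimated slicewise by Cauchy–Schwarz and the `L¹_t L²_x`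
   convergence of step 1.
6. *The parabolic class* by weak lower semicontinuity of `∫₀ᵀ ‖∇·‖²_{L²}`
   (`Torus.lintegral_eScalarGradNormSq_le_liminf_of_weakLimit`).

## Tree / Mathlib search

Tree (reused by name): `Torus.exists_isWeakScalarTransportOn_of_abs_le` (`PassiveScalarBoundedExistence`),
`Torus.IsWeakScalarTransportOn.of_tendsto_of_lintegral_lintegral_sq_lt_top` (`PassiveScalarLimitL2tx`, the
`L²_{t,x}` template of step 5), `Torus.lintegral_eScalarGradNormSq_le_liminf_of_weakLimit`
(`PassiveScalarWeakLscDissipation`), `FunctionSpaces.Torus.exists_strictMono_weakLimit_of_lintegral_sq_le`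
(`SpaceTimeWeakCompactness`), `Torus.exists_isSmooth_tendsto_eLpNorm_sub` (`PassiveScalarExistenceApprox`).
Mathlib: `ENNReal.lintegral_mul_le_Lp_mul_Lq`, `ENNReal.lintegral_Lp_add_le`,
`MeasureTheory.tendsto_setLIntegral_zero`, `MeasureTheory.tendsto_measure_iInter_atTop`.

## References

* P. Bonicatto, G. Ciampa, G. Crippa, J. Evol. Equ. 24 (2024), Paper No. 1 = arXiv:2306.15529, §2,
  Def. 2.1, Def. 2.3, Prop. 2.4 and its proof. [`BonicattoCiampaCrippa2023`]
* R. J. DiPerna, P.-L. Lions, Invent. Math. 98 (1989), 511–547, Prop. II.1, Thm. II.3 (proof, p. 522).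
  [`DiPernaLions1989`]
* H. Brezis, *Functional Analysis, Sobolev Spaces and Partial Differential Equations* (Springer 2011),
  Cor. 3.30. [`Brezis2011`]
-/

open MeasureTheory Set Filter Function
open scoped ENNReal NNReal Topology InnerProductSpace

noncomputable section

namespace Literature.Analysis.FluidPDE

open Literature.Analysis.FunctionSpaces

namespace Torus

variable {d : Type*} [Fintype d]

/-! ## Existence of parabolic solutions for `L¹_t L²_x` drifts (Bonicatto–Ciampa–Crippa 2024,
Prop. 2.4): slicewise Cauchy–Schwarz bookkeeping -/

section SliceCS

variable {E F : Type*} [NormedAddCommGroup E] [NormedAddCommGroup F]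

omit [Fintype d] in
/-- Cauchy–Schwarz on one slice, lower-integral form: `∫ ‖u‖‖f‖ ≤ ‖u‖_{L²} ‖f‖_{L²}`. [folklore] -/
private theorem lintegral_enorm_mul_le_sqrt_mul_sqrt {α : Type*} {m : MeasurableSpace α} {μ : Measure α}
    {u : α → E} {f : α → F} (hu : AEStronglyMeasurable u μ) (hf : AEStronglyMeasurable f μ) :
    ∫⁻ x, ‖u x‖ₑ * ‖f x‖ₑ ∂μ ≤
      (∫⁻ x, ‖u x‖ₑ ^ 2 ∂μ) ^ (1 / 2 : ℝ) * (∫⁻ x, ‖f x‖ₑ ^ 2 ∂μ) ^ (1 / 2 : ℝ) := by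
  have h := ENNReal.lintegral_mul_le_Lp_mul_Lq μ Real.HolderConjugate.two_two hu.enorm hf.enorm
  have e2 : ∀ g : α → ℝ≥0∞, (∫⁻ x, g x ^ (2 : ℝ) ∂μ) = ∫⁻ x, g x ^ 2 ∂μ := fun g => by
    simp_rw [ENNReal.rpow_two]
  rw [e2, e2] at h
  exact h

/-- Cauchy–Schwarz slicewise, then integrated in time: for space–time fields `u`, `f` on
`(0,T) × T^d` with `∫ |f(t)|² ≤ C` for a.e. `t`,
`∫₀ᵀ∫ ‖u‖‖f‖ ≤ (∫₀ᵀ ‖u(t)‖_{L²} dt) · C^{1/2}`. [folklore] -/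
private theorem lintegral_lintegral_enorm_mul_le_of_sq_le {T : ℝ} {C : ℝ≥0∞}
    {u : ℝ → UnitAddTorus d → E} {f : ℝ → UnitAddTorus d → F}
    (hu : AEStronglyMeasurable (uncurry u) (((volume : Measure ℝ).restrict (Ioo 0 T)).prod volume))
    (hf : AEStronglyMeasurable (uncurry f) (((volume : Measure ℝ).restrict (Ioo 0 T)).prod volume))
    (hfb : ∀ᵐ t ∂(volume.restrict (Ioo 0 T)), ∫⁻ x, ‖f t x‖ₑ ^ 2 ≤ C) :
    ∫⁻ t in Ioo 0 T, ∫⁻ x, ‖u t x‖ₑ * ‖f t x‖ₑ ≤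
      (∫⁻ t in Ioo 0 T, (∫⁻ x, ‖u t x‖ₑ ^ 2) ^ (1 / 2 : ℝ)) * C ^ (1 / 2 : ℝ) := by
  have hus : ∀ᵐ t ∂(volume.restrict (Ioo 0 T)), AEStronglyMeasurable (u t) volume := hu.prodMk_left
  have hfs : ∀ᵐ t ∂(volume.restrict (Ioo 0 T)), AEStronglyMeasurable (f t) volume := hf.prodMk_left
  have hu12 : AEMeasurable (fun t => (∫⁻ x, ‖u t x‖ₑ ^ 2) ^ (1 / 2 : ℝ))
      ((volume : Measure ℝ).restrict (Ioo 0 T)) :=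
    (hu.enorm.pow_const 2).lintegral_prod_right'.pow_const _
  calc ∫⁻ t in Ioo 0 T, ∫⁻ x, ‖u t x‖ₑ * ‖f t x‖ₑ
      ≤ ∫⁻ t in Ioo 0 T, (∫⁻ x, ‖u t x‖ₑ ^ 2) ^ (1 / 2 : ℝ) * C ^ (1 / 2 : ℝ) := by
        refine lintegral_mono_ae ?_
        filter_upwards [hfb, hfs, hus] with t htb htm hutm
        calc ∫⁻ x, ‖u t x‖ₑ * ‖f t x‖ₑ
            ≤ (∫⁻ x, ‖u t x‖ₑ ^ 2) ^ (1 / 2 : ℝ) * (∫⁻ x, ‖f t x‖ₑ ^ 2) ^ (1 / 2 : ℝ) :=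
              lintegral_enorm_mul_le_sqrt_mul_sqrt hutm htm
          _ ≤ (∫⁻ x, ‖u t x‖ₑ ^ 2) ^ (1 / 2 : ℝ) * C ^ (1 / 2 : ℝ) := by gcongr
    _ = (∫⁻ t in Ioo 0 T, (∫⁻ x, ‖u t x‖ₑ ^ 2) ^ (1 / 2 : ℝ)) * C ^ (1 / 2 : ℝ) :=
        lintegral_mul_const'' _ hu12

/-- Integrability of a pairing `f G` on `(0,T) × T^d` for `f ∈ L^∞_t L²_x` and `G ∈ L¹_t L²_x`,
with the bound `∫∫ |f G| ≤ ‖G‖_{L¹_t L²_x} C^{1/2}`. [folklore] -/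
private theorem integrable_mul_of_sq_le_of_lintegral_sqrt_lt_top {T : ℝ} {C : ℝ≥0∞} (hC : C ≠ ⊤)
    {f G : ℝ → UnitAddTorus d → ℝ}
    (hf : AEStronglyMeasurable (uncurry f) (((volume : Measure ℝ).restrict (Ioo 0 T)).prod volume))
    (hfb : ∀ᵐ t ∂(volume.restrict (Ioo 0 T)), ∫⁻ x, ‖f t x‖ₑ ^ 2 ≤ C)
    (hG : AEStronglyMeasurable (uncurry G) (((volume : Measure ℝ).restrict (Ioo 0 T)).prod volume))
    (hG1 : ∫⁻ t in Ioo 0 T, (∫⁻ x, ‖G t x‖ₑ ^ 2) ^ (1 / 2 : ℝ) < ⊤) :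
    Integrable (fun p : ℝ × UnitAddTorus d => f p.1 p.2 * G p.1 p.2)
        (((volume : Measure ℝ).restrict (Ioo 0 T)).prod volume) ∧
      ∫⁻ p, ‖f p.1 p.2 * G p.1 p.2‖ₑ ∂(((volume : Measure ℝ).restrict (Ioo 0 T)).prod volume) ≤
        (∫⁻ t in Ioo 0 T, (∫⁻ x, ‖G t x‖ₑ ^ 2) ^ (1 / 2 : ℝ)) * C ^ (1 / 2 : ℝ) := by
  have hm : AEStronglyMeasurable (fun p : ℝ × UnitAddTorus d => f p.1 p.2 * G p.1 p.2)
      (((volume : Measure ℝ).restrict (Ioo 0 T)).prod volume) := hf.mul hG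
  have hle : ∫⁻ p, ‖f p.1 p.2 * G p.1 p.2‖ₑ ∂(((volume : Measure ℝ).restrict (Ioo 0 T)).prod volume) ≤
      (∫⁻ t in Ioo 0 T, (∫⁻ x, ‖G t x‖ₑ ^ 2) ^ (1 / 2 : ℝ)) * C ^ (1 / 2 : ℝ) := by
    have e : ∫⁻ p, ‖f p.1 p.2 * G p.1 p.2‖ₑ ∂(((volume : Measure ℝ).restrict (Ioo 0 T)).prod volume) =
        ∫⁻ t in Ioo 0 T, ∫⁻ x, ‖G t x‖ₑ * ‖f t x‖ₑ := by
      rw [lintegral_prod _ hm.enorm]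
      refine lintegral_congr fun t => lintegral_congr fun x => ?_
      rw [enorm_mul, mul_comm]
    rw [e]
    exact lintegral_lintegral_enorm_mul_le_of_sq_le hG hf hfb
  refine ⟨⟨hm, ?_⟩, hle⟩
  exact lt_of_le_of_lt hle (ENNReal.mul_lt_top hG1 (ENNReal.rpow_lt_top_of_nonneg (by norm_num) hC))

end SliceCS

/-! ## Truncation in time at the level sets of the slice norm -/

section TimeTrunc

variable {F : Type*} [NormedAddCommGroup F]

/-- Measurability of the time-truncated field `1_{N(t) ≤ K²} w(t, x)`. [folklore] -/
private theorem aestronglyMeasurable_uncurry_timeTrunc {S : Set ℝ} {w : ℝ → UnitAddTorus d → F}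
    {N : ℝ → ℝ≥0∞}
    (hw : AEStronglyMeasurable (uncurry w) (((volume : Measure ℝ).restrict S).prod volume))
    (hN : Measurable N) (K : ℕ) :
    AEStronglyMeasurable (uncurry fun t x => if N t ≤ (K : ℝ≥0∞) ^ 2 then w t x else 0)
      (((volume : Measure ℝ).restrict S).prod volume) := by
  have hA : MeasurableSet {p : ℝ × UnitAddTorus d | N p.1 ≤ (K : ℝ≥0∞) ^ 2} :=
    measurableSet_le (hN.comp measurable_fst) measurable_const
  have e : (uncurry fun t x => if N t ≤ (K : ℝ≥0∞) ^ 2 then w t x else 0) =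
      {p : ℝ × UnitAddTorus d | N p.1 ≤ (K : ℝ≥0∞) ^ 2}.indicator (uncurry w) := by
    funext p
    simp only [uncurry, Set.indicator_apply, Set.mem_setOf_eq]
  rw [e]
  exact hw.indicator hA

/-- The slice norm of the truncated field. [folklore] -/
private theorem lintegral_sq_timeTrunc_slice (N : ℝ → ℝ≥0∞) (K : ℕ) (w : ℝ → UnitAddTorus d → F) (t : ℝ) :
    ∫⁻ x, ‖(if N t ≤ (K : ℝ≥0∞) ^ 2 then w t x else 0)‖ₑ ^ 2 =
      if N t ≤ (K : ℝ≥0∞) ^ 2 then ∫⁻ x, ‖w t x‖ₑ ^ 2 else 0 := by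
  split_ifs with h
  · rfl
  · simp

/-- The slice norm of the truncation error. [folklore] -/
private theorem lintegral_sq_timeTrunc_sub_slice (N : ℝ → ℝ≥0∞) (K : ℕ) (w : ℝ → UnitAddTorus d → F)
    (t : ℝ) :
    ∫⁻ x, ‖(if N t ≤ (K : ℝ≥0∞) ^ 2 then w t x else 0) - w t x‖ₑ ^ 2 =
      if N t ≤ (K : ℝ≥0∞) ^ 2 then 0 else ∫⁻ x, ‖w t x‖ₑ ^ 2 := by
  split_ifs with h
  · simp
  · simp

/-- The truncated field is square integrable on `(0,T) × T^d`: `∫₀ᵀ∫ |w_K|² ≤ K² T`. [folklore] -/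
private theorem lintegral_lintegral_sq_timeTrunc_le {T : ℝ} {w : ℝ → UnitAddTorus d → F} {N : ℝ → ℝ≥0∞}
    (hN : ∀ᵐ t ∂(volume.restrict (Ioo 0 T)), N t = ∫⁻ x, ‖w t x‖ₑ ^ 2) (K : ℕ) :
    ∫⁻ t in Ioo 0 T, ∫⁻ x, ‖(if N t ≤ (K : ℝ≥0∞) ^ 2 then w t x else 0)‖ₑ ^ 2 ≤
      (K : ℝ≥0∞) ^ 2 * volume (Ioo (0 : ℝ) T) := by
  calc ∫⁻ t in Ioo 0 T, ∫⁻ x, ‖(if N t ≤ (K : ℝ≥0∞) ^ 2 then w t x else 0)‖ₑ ^ 2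
      ≤ ∫⁻ _ in Ioo 0 T, (K : ℝ≥0∞) ^ 2 := by
        refine lintegral_mono_ae ?_
        filter_upwards [hN] with t ht
        rw [lintegral_sq_timeTrunc_slice]
        split_ifs with h
        · rw [← ht]; exact h
        · exact zero_le
    _ = (K : ℝ≥0∞) ^ 2 * volume (Ioo (0 : ℝ) T) := by rw [lintegral_const, Measure.restrict_apply_univ]

/-- Slicewise bound of the truncated field: `∫ |w_K(t)|² ≤ K²` for a.e. `t`. [folklore] -/
private theorem ae_lintegral_sq_timeTrunc_le {T : ℝ} {w : ℝ → UnitAddTorus d → F} {N : ℝ → ℝ≥0∞}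
    (hN : ∀ᵐ t ∂(volume.restrict (Ioo 0 T)), N t = ∫⁻ x, ‖w t x‖ₑ ^ 2) (K : ℕ) :
    ∀ᵐ t ∂(volume.restrict (Ioo 0 T)),
      ∫⁻ x, ‖(if N t ≤ (K : ℝ≥0∞) ^ 2 then w t x else 0)‖ₑ ^ 2 ≤ (K : ℝ≥0∞) ^ 2 := by
  filter_upwards [hN] with t ht
  rw [lintegral_sq_timeTrunc_slice]
  split_ifs with h
  · rw [← ht]; exact h
  · exact zero_le

/-- The `L¹_t L²_x` size of the truncation error is the tail `∫_{N > K²} N^{1/2}`. [folklore] -/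
private theorem lintegral_sqrt_timeTrunc_sub_eq {T : ℝ} {w : ℝ → UnitAddTorus d → F} {N : ℝ → ℝ≥0∞}
    (hNm : Measurable N) (hN : ∀ᵐ t ∂(volume.restrict (Ioo 0 T)), N t = ∫⁻ x, ‖w t x‖ₑ ^ 2)
    (K : ℕ) :
    ∫⁻ t in Ioo 0 T, (∫⁻ x, ‖(if N t ≤ (K : ℝ≥0∞) ^ 2 then w t x else 0) - w t x‖ₑ ^ 2) ^ (1 / 2 : ℝ) =
      ∫⁻ t in {t | (K : ℝ≥0∞) ^ 2 < N t}, N t ^ (1 / 2 : ℝ) ∂(volume.restrict (Ioo 0 T)) := by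
  have hS : MeasurableSet {t | (K : ℝ≥0∞) ^ 2 < N t} := measurableSet_lt measurable_const hNm
  rw [← lintegral_indicator hS]
  refine lintegral_congr_ae ?_
  filter_upwards [hN] with t ht
  rw [lintegral_sq_timeTrunc_sub_slice]
  simp only [Set.indicator_apply, Set.mem_setOf_eq]
  by_cases h : N t ≤ (K : ℝ≥0∞) ^ 2
  · rw [if_pos h, if_neg (not_lt.2 h), ENNReal.zero_rpow_of_pos (by norm_num)]
  · rw [if_neg h, if_pos (not_le.1 h), ht]

/-- The tails `∫_{(0,T) ∩ {N > K²}} N^{1/2}` of an integrable `N^{1/2}` tend to zero. [folklore] -/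
private theorem tendsto_setLIntegral_sqrt_gt_sq {T : ℝ} {N : ℝ → ℝ≥0∞} (hNm : Measurable N)
    (hfin : ∫⁻ t in Ioo 0 T, N t ^ (1 / 2 : ℝ) < ⊤) :
    Tendsto (fun K : ℕ => ∫⁻ t in {t | (K : ℝ≥0∞) ^ 2 < N t}, N t ^ (1 / 2 : ℝ)
      ∂(volume.restrict (Ioo 0 T))) atTop (𝓝 0) := by
  set μT : Measure ℝ := (volume : Measure ℝ).restrict (Ioo 0 T) with hμT
  haveI : IsFiniteMeasure μT := isFiniteMeasure_restrict.2 measure_Ioo_lt_top.ne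
  refine tendsto_setLIntegral_zero hfin.ne ?_
  have hS : ∀ K : ℕ, MeasurableSet {t | (K : ℝ≥0∞) ^ 2 < N t} := fun K =>
    measurableSet_lt measurable_const hNm
  have hanti : Antitone (fun K : ℕ => {t | (K : ℝ≥0∞) ^ 2 < N t}) := by
    intro K L hKL t ht
    simp only [Set.mem_setOf_eq] at ht ⊢
    exact lt_of_le_of_lt (by gcongr) ht
  have hlim := tendsto_measure_iInter_atTop (μ := μT) (fun K => (hS K).nullMeasurableSet) hanti
    ⟨0, measure_ne_top _ _⟩
  have hnull : μT (⋂ K : ℕ, {t | (K : ℝ≥0∞) ^ 2 < N t}) = 0 := by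
    have hsub : (⋂ K : ℕ, {t | (K : ℝ≥0∞) ^ 2 < N t}) ⊆ {t | ¬ (N t ^ (1 / 2 : ℝ) < ⊤)} := by
      intro t ht
      simp only [Set.mem_iInter, Set.mem_setOf_eq] at ht ⊢
      intro hlt
      have hne : N t ≠ ⊤ := by
        intro htop
        rw [htop, ENNReal.top_rpow_of_pos (by norm_num)] at hlt
        exact lt_irrefl _ hlt
      obtain ⟨n, hn⟩ := ENNReal.exists_nat_gt hne
      have hn1 : (n : ℝ≥0∞) ≤ (n : ℝ≥0∞) ^ 2 := by
        rcases Nat.eq_zero_or_pos n with h0 | hpos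
        · simp [h0]
        · exact le_self_pow₀ (by exact_mod_cast hpos) two_ne_zero
      exact lt_irrefl _ (((ht n).trans hn).trans_le hn1)
    have hae : ∀ᵐ t ∂μT, N t ^ (1 / 2 : ℝ) < ⊤ := ae_lt_top (hNm.pow_const _) hfin.ne
    exact measure_mono_null hsub (ae_iff.1 hae)
  rw [hnull] at hlim
  exact hlim

end TimeTrunc

/-! ## Weak-* limits in `L^∞_t L²_x` tested against `L¹_t L²_x` fields -/

section WeakUpgrade

/-- **Weak-* convergence in `L^∞(0,T; L²(T^d))` tested against `L¹(0,T; L²(T^d))`.** If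
`θⱼ ⇀ W` weakly in `L²((0,T) × T^d)` (pairings against square-integrable space–time fields
converge — the output of `exists_strictMono_weakLimit_of_lintegral_sq_le`) and `θⱼ`, `W` are bounded
in `L^∞(0,T; L²)` by the same constant, then the pairings against every `G ∈ L¹(0,T; L²(T^d))`
converge as well: truncate `G` in time where `‖G(t)‖_{L²} ≤ K` (a square-integrable field) and
control the remainder uniformly in `j` by `C^{1/2} ∫_{‖G(t)‖ > K} ‖G(t)‖_{L²} dt → 0` (Brezis 2011,
Cor. 3.30: on bounded sets weak-* convergence may be tested on a dense subset of the predual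
`L¹(0,T; L²)`). [cite: Brezis2011, Cor. 3.30] -/
theorem tendsto_integral_mul_of_weakLimit_of_lintegral_sqrt_lt_top {T : ℝ} {C : ℝ≥0}
    {θ : ℕ → ℝ → UnitAddTorus d → ℝ} {W : ℝ → UnitAddTorus d → ℝ}
    (hm : ∀ j, AEStronglyMeasurable (FunctionSpaces.Torus.stLift (θ j)) (volume.restrict (Ioo 0 T ×ˢ univ)))
    (hb : ∀ j, ∀ᵐ t ∂(volume.restrict (Ioo 0 T)), ∫⁻ x, ‖θ j t x‖ₑ ^ 2 ≤ C)
    (hWm : AEStronglyMeasurable (FunctionSpaces.Torus.stLift W) (volume.restrict (Ioo 0 T ×ˢ univ)))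
    (hWb : ∀ᵐ t ∂(volume.restrict (Ioo 0 T)), ∫⁻ x, ‖W t x‖ₑ ^ 2 ≤ C)
    (hlim : ∀ G : ℝ → UnitAddTorus d → ℝ,
      AEStronglyMeasurable (FunctionSpaces.Torus.stLift G) (volume.restrict (Ioo 0 T ×ˢ univ)) →
      ∫⁻ t in Ioo 0 T, ∫⁻ x, ‖G t x‖ₑ ^ 2 < ∞ →
      Tendsto (fun j => ∫ t in Ioo 0 T, ∫ x, θ j t x * G t x) atTop
        (𝓝 (∫ t in Ioo 0 T, ∫ x, W t x * G t x)))
    {G : ℝ → UnitAddTorus d → ℝ}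
    (hGm : AEStronglyMeasurable (FunctionSpaces.Torus.stLift G) (volume.restrict (Ioo 0 T ×ˢ univ)))
    (hG1 : ∫⁻ t in Ioo 0 T, (∫⁻ x, ‖G t x‖ₑ ^ 2) ^ (1 / 2 : ℝ) < ∞) :
    Tendsto (fun j => ∫ t in Ioo 0 T, ∫ x, θ j t x * G t x) atTop
      (𝓝 (∫ t in Ioo 0 T, ∫ x, W t x * G t x)) := by
  set μT : Measure ℝ := (volume : Measure ℝ).restrict (Ioo 0 T) with hμT
  set μ : Measure (ℝ × UnitAddTorus d) := μT.prod (volume : Measure (UnitAddTorus d)) with hμ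
  haveI : IsFiniteMeasure μT := isFiniteMeasure_restrict.2 measure_Ioo_lt_top.ne
  have hCtop : (C : ℝ≥0∞) ≠ ⊤ := ENNReal.coe_ne_top
  have hC12 : (C : ℝ≥0∞) ^ (1 / 2 : ℝ) ≠ ⊤ := ENNReal.rpow_ne_top_of_nonneg (by norm_num) hCtop
  -- uncurried measurability
  have hθu : ∀ j, AEStronglyMeasurable (uncurry (θ j)) μ := fun j =>
    FunctionSpaces.Torus.aestronglyMeasurable_uncurry_of_stLift_prod (hm j)
  have hWu : AEStronglyMeasurable (uncurry W) μ := FunctionSpaces.Torus.aestronglyMeasurable_uncurry_of_stLift_prod hWm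
  have hGu : AEStronglyMeasurable (uncurry G) μ := FunctionSpaces.Torus.aestronglyMeasurable_uncurry_of_stLift_prod hGm
  -- the slice norm of `G` and a measurable modification
  have hN₀m : AEMeasurable (fun t => ∫⁻ x, ‖G t x‖ₑ ^ 2) μT := (hGu.enorm.pow_const 2).lintegral_prod_right'
  obtain ⟨N, hNm, hNN⟩ : ∃ N : ℝ → ℝ≥0∞, Measurable N ∧ ∀ᵐ t ∂μT, N t = ∫⁻ x, ‖G t x‖ₑ ^ 2 :=
    ⟨hN₀m.mk _, hN₀m.measurable_mk, hN₀m.ae_eq_mk.mono fun t ht => ht.symm⟩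
  have hNfin : ∫⁻ t, N t ^ (1 / 2 : ℝ) ∂μT < ⊤ := by
    have e : ∫⁻ t, N t ^ (1 / 2 : ℝ) ∂μT = ∫⁻ t, (∫⁻ x, ‖G t x‖ₑ ^ 2) ^ (1 / 2 : ℝ) ∂μT :=
      lintegral_congr_ae (hNN.mono fun t ht => by simp only [ht])
    rw [e]
    exact hG1
  -- the truncated fields `G_K = 1_{N ≤ K²} G`
  set GK : ℕ → ℝ → UnitAddTorus d → ℝ := fun K t x => if N t ≤ (K : ℝ≥0∞) ^ 2 then G t x else 0
    with hGK
  have hGKu : ∀ K, AEStronglyMeasurable (uncurry (GK K)) μ := fun K =>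
    aestronglyMeasurable_uncurry_timeTrunc hGu hNm K
  have hGKst : ∀ K, AEStronglyMeasurable (FunctionSpaces.Torus.stLift (GK K)) (volume.restrict (Ioo 0 T ×ˢ univ)) :=
    fun K => FunctionSpaces.Torus.aestronglyMeasurable_stLift_of_uncurry (hGKu K)
  have hGK2 : ∀ K, ∫⁻ t in Ioo 0 T, ∫⁻ x, ‖GK K t x‖ₑ ^ 2 < ⊤ := fun K =>
    lt_of_le_of_lt (lintegral_lintegral_sq_timeTrunc_le hNN K)
      (ENNReal.mul_lt_top (ENNReal.pow_lt_top ENNReal.coe_lt_top) measure_Ioo_lt_top)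
  have hGK1 : ∀ K, ∫⁻ t in Ioo 0 T, (∫⁻ x, ‖GK K t x‖ₑ ^ 2) ^ (1 / 2 : ℝ) < ⊤ := by
    intro K
    calc ∫⁻ t in Ioo 0 T, (∫⁻ x, ‖GK K t x‖ₑ ^ 2) ^ (1 / 2 : ℝ)
        ≤ ∫⁻ _ in Ioo 0 T, ((K : ℝ≥0∞) ^ 2) ^ (1 / 2 : ℝ) := by
          refine lintegral_mono_ae ?_
          filter_upwards [ae_lintegral_sq_timeTrunc_le hNN K] with t ht
          exact ENNReal.rpow_le_rpow ht (by norm_num)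
      _ < ⊤ := by
          rw [lintegral_const, Measure.restrict_apply_univ]
          exact ENNReal.mul_lt_top (ENNReal.rpow_lt_top_of_nonneg (by norm_num)
            (ENNReal.pow_ne_top ENNReal.coe_ne_top)) measure_Ioo_lt_top
  -- the tails
  set tail : ℕ → ℝ≥0∞ := fun K => ∫⁻ t in {t | (K : ℝ≥0∞) ^ 2 < N t}, N t ^ (1 / 2 : ℝ) ∂μT
    with htail_def
  have htail : Tendsto tail atTop (𝓝 0) := tendsto_setLIntegral_sqrt_gt_sq hNm hNfin
  have htail_fin : ∀ K, tail K ≠ ⊤ := fun K =>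
    (lt_of_le_of_lt (setLIntegral_le_lintegral _ _) hNfin).ne
  have hdist : ∀ K, ∫⁻ t in Ioo 0 T, (∫⁻ x, ‖GK K t x - G t x‖ₑ ^ 2) ^ (1 / 2 : ℝ) = tail K :=
    fun K => lintegral_sqrt_timeTrunc_sub_eq hNm hNN K
  -- pairing bounds for a field `f` of the class
  have hpair : ∀ f : ℝ → UnitAddTorus d → ℝ, AEStronglyMeasurable (uncurry f) μ →
      (∀ᵐ t ∂μT, ∫⁻ x, ‖f t x‖ₑ ^ 2 ≤ C) → ∀ K,
      Integrable (fun p : ℝ × UnitAddTorus d => f p.1 p.2 * G p.1 p.2) μ ∧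
      Integrable (fun p : ℝ × UnitAddTorus d => f p.1 p.2 * GK K p.1 p.2) μ ∧
      ‖(∫ p, f p.1 p.2 * G p.1 p.2 ∂μ) - ∫ p, f p.1 p.2 * GK K p.1 p.2 ∂μ‖ ≤
        ((C : ℝ≥0∞) ^ (1 / 2 : ℝ) * tail K).toReal := by
    intro f hf hfb K
    have hiG := integrable_mul_of_sq_le_of_lintegral_sqrt_lt_top hCtop hf hfb hGu hG1
    have hiGK := integrable_mul_of_sq_le_of_lintegral_sqrt_lt_top hCtop hf hfb (hGKu K) (hGK1 K)
    refine ⟨hiG.1, hiGK.1, ?_⟩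
    have hdu : AEStronglyMeasurable (uncurry fun t x => GK K t x - G t x) μ := (hGKu K).sub hGu
    have hiD := integrable_mul_of_sq_le_of_lintegral_sqrt_lt_top hCtop hf hfb hdu
      (by rw [hdist K]; exact lt_top_iff_ne_top.2 (htail_fin K))
    rw [← integral_sub hiG.1 hiGK.1]
    have e : (fun p : ℝ × UnitAddTorus d => f p.1 p.2 * G p.1 p.2 - f p.1 p.2 * GK K p.1 p.2) =
        fun p => -(f p.1 p.2 * (GK K p.1 p.2 - G p.1 p.2)) := by
      funext p; ring
    rw [e, integral_neg, norm_neg]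
    have h1 : ‖∫ p, f p.1 p.2 * (GK K p.1 p.2 - G p.1 p.2) ∂μ‖ ≤
        (∫⁻ p, ‖f p.1 p.2 * (GK K p.1 p.2 - G p.1 p.2)‖ₑ ∂μ).toReal := by
      rw [← integral_norm_eq_lintegral_enorm hiD.1.1]
      exact norm_integral_le_integral_norm _
    refine h1.trans (ENNReal.toReal_mono (ENNReal.mul_ne_top hC12 (htail_fin K)) ?_)
    calc ∫⁻ p, ‖f p.1 p.2 * (GK K p.1 p.2 - G p.1 p.2)‖ₑ ∂μ
        ≤ (∫⁻ t in Ioo 0 T, (∫⁻ x, ‖GK K t x - G t x‖ₑ ^ 2) ^ (1 / 2 : ℝ)) * (C : ℝ≥0∞) ^ (1 / 2 : ℝ) :=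
          hiD.2
      _ = (C : ℝ≥0∞) ^ (1 / 2 : ℝ) * tail K := by rw [hdist K, mul_comm]
  -- the real error `e_K → 0`
  have heK : Tendsto (fun K => ((C : ℝ≥0∞) ^ (1 / 2 : ℝ) * tail K).toReal) atTop (𝓝 0) := by
    have h1 := ENNReal.Tendsto.const_mul htail (Or.inr hC12) (a := (C : ℝ≥0∞) ^ (1 / 2 : ℝ))
    rw [mul_zero] at h1
    have h2 := (ENNReal.tendsto_toReal ENNReal.zero_ne_top).comp h1
    rwa [ENNReal.toReal_zero] at h2
  -- iterated integrals as product integrals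
  have hprod : ∀ (f F : ℝ → UnitAddTorus d → ℝ),
      Integrable (fun p : ℝ × UnitAddTorus d => f p.1 p.2 * F p.1 p.2) μ →
      (∫ t in Ioo 0 T, ∫ x, f t x * F t x) = ∫ p, f p.1 p.2 * F p.1 p.2 ∂μ :=
    fun f F hi => (integral_prod _ hi).symm
  -- the `ε/3` argument
  rw [Metric.tendsto_atTop]
  intro ε hε
  have hε3 : 0 < ε / 3 := by positivity
  obtain ⟨K, hK⟩ := (Metric.tendsto_atTop.1 heK) (ε / 3) hε3
  have hK' : ((C : ℝ≥0∞) ^ (1 / 2 : ℝ) * tail K).toReal < ε / 3 := by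
    have h := hK K le_rfl
    rwa [Real.dist_eq, sub_zero, abs_of_nonneg ENNReal.toReal_nonneg] at h
  obtain ⟨J, hJ⟩ := (Metric.tendsto_atTop.1 (hlim (GK K) (hGKst K) (hGK2 K))) (ε / 3) hε3
  refine ⟨J, fun j hj => ?_⟩
  obtain ⟨hθG, hθGK, hθe⟩ := hpair (θ j) (hθu j) (hb j) K
  obtain ⟨hWG, hWGK, hWe⟩ := hpair W hWu hWb K
  have hmid := hJ j hj
  rw [dist_eq_norm] at hmid ⊢
  rw [hprod _ _ hθGK, hprod _ _ hWGK] at hmid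
  rw [hprod _ _ hθG, hprod _ _ hWG]
  calc ‖(∫ p, θ j p.1 p.2 * G p.1 p.2 ∂μ) - ∫ p, W p.1 p.2 * G p.1 p.2 ∂μ‖
      = ‖((∫ p, θ j p.1 p.2 * G p.1 p.2 ∂μ) - ∫ p, θ j p.1 p.2 * GK K p.1 p.2 ∂μ) +
          ((∫ p, θ j p.1 p.2 * GK K p.1 p.2 ∂μ) - ∫ p, W p.1 p.2 * GK K p.1 p.2 ∂μ) -
          ((∫ p, W p.1 p.2 * G p.1 p.2 ∂μ) - ∫ p, W p.1 p.2 * GK K p.1 p.2 ∂μ)‖ := by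
        congr 1; ring
    _ ≤ ‖(∫ p, θ j p.1 p.2 * G p.1 p.2 ∂μ) - ∫ p, θ j p.1 p.2 * GK K p.1 p.2 ∂μ‖ +
          ‖(∫ p, θ j p.1 p.2 * GK K p.1 p.2 ∂μ) - ∫ p, W p.1 p.2 * GK K p.1 p.2 ∂μ‖ +
          ‖(∫ p, W p.1 p.2 * G p.1 p.2 ∂μ) - ∫ p, W p.1 p.2 * GK K p.1 p.2 ∂μ‖ :=
        norm_sub_le_of_le (norm_add_le _ _) le_rfl
    _ < ε / 3 + ε / 3 + ε / 3 := by
        gcongr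
        · exact lt_of_le_of_lt hθe hK'
        · exact lt_of_le_of_lt hWe hK'
    _ = ε := by ring

end WeakUpgrade

/-! ## Identification of weak limits of weak passive scalars, `L¹_t L²_x` drift -/

section Limit

variable {T κ : ℝ} {C : ℝ≥0} {u : ℝ → UnitAddTorus d → EuclideanSpace ℝ d}
  {v : ℕ → ℝ → UnitAddTorus d → EuclideanSpace ℝ d} {θ₀ : UnitAddTorus d → ℝ}
  {g : ℕ → UnitAddTorus d → ℝ} {θ : ℕ → ℝ → UnitAddTorus d → ℝ} {W : ℝ → UnitAddTorus d → ℝ}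

/-- **Stability of weak solutions under weak-* convergence, `L¹_t L²_x` drift** (the passage to
the limit of DiPerna–Lions 1989, proof of Prop. II.1 / Thm. II.3, here for a limit drift in the
standing class `u ∈ L¹(0,T; L²(T^d))` of the weak formulation — the class of Bonicatto–Ciampa–Crippa
2024, Prop. 2.4): weak solutions `θₙ` of `∂ₜθₙ + vₙ·∇θₙ = κΔθₙ` with data `gₙ`, uniformly bounded in
`L^∞(0,T;L²)`, converging weakly in `L²((0,T) × T^d)` to `W`; `vₙ → u` in `L¹(0,T; L²(T^d))`,
`gₙ → θ₀` in `L²`; then `W` is a weak solution with drift `u` and datum `θ₀`. Same skeleton as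
`IsWeakScalarTransportOn.of_tendsto_of_lintegral_lintegral_sq_lt_top`; the weak-formulation integrand
`∂ₜψ + u·∇ψ + κΔψ` is now only in `L¹_t L²_x`, so the weak convergence is the upgraded one
(`tendsto_integral_mul_of_weakLimit_of_lintegral_sqrt_lt_top`), and the transport error is estimated
slicewise. [cite: DiPernaLions1989, Thm. II.3, proof (p. 522)]
[cite: BonicattoCiampaCrippa2023, Prop. 2.4 (proof: regularisation and weak compactness)] -/
theorem IsWeakScalarTransportOn.of_tendsto_of_lintegral_sqrt_lt_top
    (hsol : ∀ n, IsWeakScalarTransportOn T κ (v n) (g n) (θ n))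
    (hbd : ∀ n, ∀ᵐ t ∂(volume.restrict (Ioo 0 T)), ∫⁻ x, ‖θ n t x‖ₑ ^ 2 ≤ C)
    (hWm : AEStronglyMeasurable (FunctionSpaces.Torus.stLift W) (volume.restrict (Ioo 0 T ×ˢ univ)))
    (hWb : ∀ᵐ t ∂(volume.restrict (Ioo 0 T)), ∫⁻ x, ‖W t x‖ₑ ^ 2 ≤ C)
    (hlim : ∀ G : ℝ → UnitAddTorus d → ℝ,
      AEStronglyMeasurable (FunctionSpaces.Torus.stLift G) (volume.restrict (Ioo 0 T ×ˢ univ)) →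
      ∫⁻ t in Ioo 0 T, ∫⁻ x, ‖G t x‖ₑ ^ 2 < ⊤ →
      Tendsto (fun n => ∫ t in Ioo 0 T, ∫ x, θ n t x * G t x) atTop
        (𝓝 (∫ t in Ioo 0 T, ∫ x, W t x * G t x)))
    (hum0 : AEStronglyMeasurable (FunctionSpaces.Torus.stLift u) (volume.restrict (Ioo 0 T ×ˢ univ)))
    (hu1 : ∫⁻ t in Ioo 0 T, (∫⁻ x, ‖u t x‖ₑ ^ 2) ^ (1 / 2 : ℝ) < ⊤)
    (hdiv : ∀ᵐ t ∂(volume.restrict (Ioo 0 T)), FunctionSpaces.Torus.IsWeaklyDivFree (u t))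
    (hv : Tendsto (fun n => ∫⁻ t in Ioo 0 T, (∫⁻ x, ‖v n t x - u t x‖ₑ ^ 2) ^ (1 / 2 : ℝ))
      atTop (𝓝 0))
    (hθ₀ : MemLp θ₀ 2 volume) (hg : ∀ n, MemLp (g n) 2 volume)
    (hgθ₀ : Tendsto (fun n => eLpNorm (g n - θ₀) 2 volume) atTop (𝓝 0)) :
    IsWeakScalarTransportOn T κ u θ₀ W := by
  set μ : Measure (ℝ × UnitAddTorus d) :=
    ((volume : Measure ℝ).restrict (Ioo 0 T)).prod (volume : Measure (UnitAddTorus d)) with hμ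
  haveI : IsFiniteMeasure ((volume : Measure ℝ).restrict (Ioo 0 T)) :=
    isFiniteMeasure_restrict.2 measure_Ioo_lt_top.ne
  haveI : IsFiniteMeasure μ := by rw [hμ]; infer_instance
  have hCtop : (C : ℝ≥0∞) ≠ ⊤ := ENNReal.coe_ne_top
  have hC12 : (C : ℝ≥0∞) ^ (1 / 2 : ℝ) ≠ ⊤ := ENNReal.rpow_ne_top_of_nonneg (by norm_num) hCtop
  -- the drift: measurability
  have hum : AEStronglyMeasurable (uncurry u) μ :=
    FunctionSpaces.Torus.aestronglyMeasurable_uncurry_of_stLift_prod hum0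
  have hWm' : AEStronglyMeasurable (uncurry W) μ :=
    FunctionSpaces.Torus.aestronglyMeasurable_uncurry_of_stLift_prod hWm
  refine ⟨hWm, hum0, ⟨C, hWb⟩, hu1, ?_, hdiv, fun ψ hψ => ?_⟩
  · -- `u W ∈ L¹((0,T) × T^d)` (Cauchy–Schwarz slicewise, then the `L¹_t L²_x` bound of `u`)
    exact lt_of_le_of_lt (lintegral_lintegral_enorm_mul_le_of_sq_le hum hWm' hWb)
      (ENNReal.mul_lt_top hu1 (ENNReal.rpow_lt_top_of_nonneg (by norm_num) hCtop))
  · -- the weak formulation in the limit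
    set G : ℝ → UnitAddTorus d → ℝ := fun t x =>
      FunctionSpaces.Torus.timeDeriv ψ t x + ⟪u t x, FunctionSpaces.Torus.gradient (ψ t) x⟫_ℝ +
        κ * FunctionSpaces.Torus.laplacian (ψ t) x with hG
    set H : ℕ → ℝ → UnitAddTorus d → ℝ := fun n t x =>
      ⟪v n t x - u t x, FunctionSpaces.Torus.gradient (ψ t) x⟫_ℝ with hH
    change (∫ t in Ioo 0 T, ∫ x, W t x * G t x) + ∫ x, θ₀ x * ψ 0 x = 0
    -- bounds on the test function
    obtain ⟨C₁, hC₁⟩ := exists_bound_of_continuous_uncurry hψ.continuous_uncurry_timeDeriv 0 T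
    obtain ⟨C₂, hC₂⟩ := exists_bound_of_continuous_uncurry hψ.continuous_uncurry_gradient 0 T
    obtain ⟨C₃, hC₃⟩ := exists_bound_of_continuous_uncurry hψ.continuous_uncurry_laplacian 0 T
    have hψc : Continuous (uncurry ψ) :=
      FunctionSpaces.Torus.continuous_uncurry_of_continuous_stLift hψ.1.continuous
    obtain ⟨C₀, hC₀⟩ := exists_bound_of_continuous_uncurry hψc 0 0
    have hψ0 : ∀ x, ‖ψ 0 x‖ ≤ C₀ := fun x => hC₀ 0 (left_mem_Icc.2 le_rfl) x
    have hψ0c : Continuous (ψ 0) := hψc.comp (Continuous.prodMk_right 0)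
    -- `G` is in `L¹(0,T; L²)`: slicewise `‖G(t)‖_{L²} ≤ a + |C₂| ‖u(t)‖_{L²}`
    set a : ℝ := C₁ + |κ| * C₃ with ha
    have hGbd : ∀ t ∈ Ioo 0 T, ∀ x, ‖G t x‖ₑ ≤ ENNReal.ofReal a + ENNReal.ofReal |C₂| * ‖u t x‖ₑ := by
      intro t ht x
      have hp' : t ∈ Icc 0 T := Ioo_subset_Icc_self ht
      have h1 : ‖FunctionSpaces.Torus.timeDeriv ψ t x‖ ≤ C₁ := hC₁ t hp' x
      have ha0 : 0 ≤ a := by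
        have h01 := (norm_nonneg _).trans h1
        have h03 := (norm_nonneg _).trans (hC₃ t hp' x)
        rw [ha]; positivity
      have h2 : ‖⟪u t x, FunctionSpaces.Torus.gradient (ψ t) x⟫_ℝ‖ ≤ |C₂| * ‖u t x‖ := by
        rw [mul_comm]
        exact (norm_inner_le_norm _ _).trans (mul_le_mul_of_nonneg_left ((hC₂ t hp' x).trans
          (le_abs_self _)) (norm_nonneg _))
      have h3 : ‖κ * FunctionSpaces.Torus.laplacian (ψ t) x‖ ≤ |κ| * C₃ := by
        rw [norm_mul, Real.norm_eq_abs]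
        exact mul_le_mul_of_nonneg_left (hC₃ t hp' x) (abs_nonneg _)
      have h4 : ‖G t x‖ ≤ a + |C₂| * ‖u t x‖ :=
        calc ‖G t x‖ ≤ ‖FunctionSpaces.Torus.timeDeriv ψ t x‖ +
              ‖⟪u t x, FunctionSpaces.Torus.gradient (ψ t) x⟫_ℝ‖ +
              ‖κ * FunctionSpaces.Torus.laplacian (ψ t) x‖ := norm_add₃_le
          _ ≤ a + |C₂| * ‖u t x‖ := by rw [ha]; linarith
      rw [← ofReal_norm, ← ofReal_norm, ← ENNReal.ofReal_mul (abs_nonneg _),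
        ← ENNReal.ofReal_add ha0 (by positivity)]
      exact ENNReal.ofReal_le_ofReal h4
    have hGm : AEStronglyMeasurable (uncurry G) μ := by
      change AEStronglyMeasurable (fun p : ℝ × UnitAddTorus d =>
        FunctionSpaces.Torus.timeDeriv ψ p.1 p.2 + ⟪u p.1 p.2, FunctionSpaces.Torus.gradient (ψ p.1) p.2⟫_ℝ +
          κ * FunctionSpaces.Torus.laplacian (ψ p.1) p.2) μ
      refine ((?_ : AEStronglyMeasurable _ μ).add ?_).add ?_
      · exact hψ.continuous_uncurry_timeDeriv.aestronglyMeasurable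
      · exact hum.inner hψ.continuous_uncurry_gradient.aestronglyMeasurable
      · exact (continuous_const.mul hψ.continuous_uncurry_laplacian).aestronglyMeasurable
    have hGst : AEStronglyMeasurable (FunctionSpaces.Torus.stLift G) (volume.restrict (Ioo 0 T ×ˢ univ)) :=
      FunctionSpaces.Torus.aestronglyMeasurable_stLift_of_uncurry hGm
    have hus : ∀ᵐ t ∂(volume.restrict (Ioo 0 T)), AEStronglyMeasurable (u t) volume := hum.prodMk_left
    have hG1 : ∫⁻ t in Ioo 0 T, (∫⁻ x, ‖G t x‖ₑ ^ 2) ^ (1 / 2 : ℝ) < ⊤ := by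
      have hslice : ∀ᵐ t ∂(volume.restrict (Ioo 0 T)), (∫⁻ x, ‖G t x‖ₑ ^ 2) ^ (1 / 2 : ℝ) ≤
          ENNReal.ofReal a + ENNReal.ofReal |C₂| * (∫⁻ x, ‖u t x‖ₑ ^ 2) ^ (1 / 2 : ℝ) := by
        filter_upwards [ae_restrict_mem measurableSet_Ioo, hus] with t ht hutm
        have e2 : ∀ f : UnitAddTorus d → ℝ≥0∞, (∫⁻ x, f x ^ (2 : ℝ)) = ∫⁻ x, f x ^ 2 := fun f => by
          simp_rw [ENNReal.rpow_two]
        have hmk : AEMeasurable (fun x => ENNReal.ofReal |C₂| * ‖u t x‖ₑ) volume :=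
          hutm.enorm.const_mul _
        calc (∫⁻ x, ‖G t x‖ₑ ^ 2) ^ (1 / 2 : ℝ)
            ≤ (∫⁻ x, (((fun _ => ENNReal.ofReal a) + fun x => ENNReal.ofReal |C₂| * ‖u t x‖ₑ :
                UnitAddTorus d → ℝ≥0∞) x) ^ (2 : ℝ)) ^ (1 / (2 : ℝ)) := by
              rw [e2]
              gcongr with x
              exact hGbd t ht x
          _ ≤ (∫⁻ _ : UnitAddTorus d, ENNReal.ofReal a ^ (2 : ℝ)) ^ (1 / (2 : ℝ)) +
                (∫⁻ x, (ENNReal.ofReal |C₂| * ‖u t x‖ₑ) ^ (2 : ℝ)) ^ (1 / (2 : ℝ)) :=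
              ENNReal.lintegral_Lp_add_le aemeasurable_const hmk one_le_two
          _ = ENNReal.ofReal a + ENNReal.ofReal |C₂| * (∫⁻ x, ‖u t x‖ₑ ^ 2) ^ (1 / 2 : ℝ) := by
              rw [lintegral_const, measure_univ, mul_one, ← ENNReal.rpow_mul]
              congr 1
              · norm_num
              · rw [e2]
                have e3 : ∫⁻ x, (ENNReal.ofReal |C₂| * ‖u t x‖ₑ) ^ 2 =
                    ENNReal.ofReal |C₂| ^ 2 * ∫⁻ x, ‖u t x‖ₑ ^ 2 := by
                  rw [← lintegral_const_mul'' _ (hutm.enorm.pow_const 2)]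
                  refine lintegral_congr fun x => ?_
                  rw [mul_pow]
                rw [e3, ENNReal.mul_rpow_of_nonneg _ _ (by norm_num : (0 : ℝ) ≤ 1 / 2),
                  ← ENNReal.rpow_natCast, ← ENNReal.rpow_mul]
                norm_num
      have hu12 : AEMeasurable (fun t => (∫⁻ x, ‖u t x‖ₑ ^ 2) ^ (1 / 2 : ℝ))
          ((volume : Measure ℝ).restrict (Ioo 0 T)) :=
        (hum.enorm.pow_const 2).lintegral_prod_right'.pow_const _
      calc ∫⁻ t in Ioo 0 T, (∫⁻ x, ‖G t x‖ₑ ^ 2) ^ (1 / 2 : ℝ)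
          ≤ ∫⁻ t in Ioo 0 T, (ENNReal.ofReal a + ENNReal.ofReal |C₂| * (∫⁻ x, ‖u t x‖ₑ ^ 2) ^ (1 / 2 : ℝ)) :=
            lintegral_mono_ae hslice
        _ = (∫⁻ _ in Ioo 0 T, ENNReal.ofReal a) +
              ENNReal.ofReal |C₂| * ∫⁻ t in Ioo 0 T, (∫⁻ x, ‖u t x‖ₑ ^ 2) ^ (1 / 2 : ℝ) := by
            rw [lintegral_add_left' aemeasurable_const, lintegral_const_mul'' _ hu12]
        _ < ⊤ := by
            refine ENNReal.add_lt_top.2 ⟨?_, ENNReal.mul_lt_top ENNReal.ofReal_lt_top hu1⟩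
            rw [lintegral_const]
            exact ENNReal.mul_lt_top ENNReal.ofReal_lt_top (measure_lt_top _ _)
    -- (a) the weak convergence `∫∫ θₙ G → ∫∫ W G`, in the upgraded form
    have hA := tendsto_integral_mul_of_weakLimit_of_lintegral_sqrt_lt_top
      (fun n => (hsol n).aestronglyMeasurable) hbd hWm hWb hlim hGst hG1
    -- (b) the splitting of the `n`-th weak identity
    have hθG : ∀ n, Integrable (fun p : ℝ × UnitAddTorus d => θ n p.1 p.2 * G p.1 p.2) μ := fun n =>
      (integrable_mul_of_sq_le_of_lintegral_sqrt_lt_top hCtop (hsol n).aestronglyMeasurable_uncurry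
        (hbd n) hGm hG1).1
    have hθGn : ∀ n, Integrable (fun p : ℝ × UnitAddTorus d => θ n p.1 p.2 *
        (FunctionSpaces.Torus.timeDeriv ψ p.1 p.2 + ⟪v n p.1 p.2, FunctionSpaces.Torus.gradient (ψ p.1) p.2⟫_ℝ +
          κ * FunctionSpaces.Torus.laplacian (ψ p.1) p.2)) μ := fun n =>
      (hsol n).integrable_weakIntegrand hψ
    have hsplit : ∀ n (p : ℝ × UnitAddTorus d), θ n p.1 p.2 *
        (FunctionSpaces.Torus.timeDeriv ψ p.1 p.2 + ⟪v n p.1 p.2, FunctionSpaces.Torus.gradient (ψ p.1) p.2⟫_ℝ +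
          κ * FunctionSpaces.Torus.laplacian (ψ p.1) p.2) =
        θ n p.1 p.2 * G p.1 p.2 + θ n p.1 p.2 * H n p.1 p.2 := by
      intro n p
      simp only [hG, hH, inner_sub_left]
      ring
    have hθH : ∀ n, Integrable (fun p : ℝ × UnitAddTorus d => θ n p.1 p.2 * H n p.1 p.2) μ := by
      intro n
      have h := (hθGn n).sub (hθG n)
      refine h.congr (Eventually.of_forall fun p => ?_)
      simp only [Pi.sub_apply, hsplit n p, add_sub_cancel_left]
    have hident : ∀ n, (∫ t in Ioo 0 T, ∫ x, θ n t x * G t x) =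
        -(∫ p, θ n p.1 p.2 * H n p.1 p.2 ∂μ) - ∫ x, g n x * ψ 0 x := by
      intro n
      have h0 := (hsol n).integral_prod_weak_eq hψ
      have h1 : (∫ p, θ n p.1 p.2 *
          (FunctionSpaces.Torus.timeDeriv ψ p.1 p.2 + ⟪v n p.1 p.2, FunctionSpaces.Torus.gradient (ψ p.1) p.2⟫_ℝ +
            κ * FunctionSpaces.Torus.laplacian (ψ p.1) p.2) ∂μ) =
          (∫ p, θ n p.1 p.2 * G p.1 p.2 ∂μ) + ∫ p, θ n p.1 p.2 * H n p.1 p.2 ∂μ := by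
        rw [← integral_add (hθG n) (hθH n)]
        exact integral_congr_ae (Eventually.of_forall fun p => hsplit n p)
      have h2 : (∫ p, θ n p.1 p.2 * G p.1 p.2 ∂μ) = ∫ t in Ioo 0 T, ∫ x, θ n t x * G t x :=
        integral_prod _ (hθG n)
      rw [h1, h2] at h0
      linarith
    -- (c) the transport error `∫∫ θₙ ⟪vₙ - u, ∇ψ⟫ → 0`, slicewise Cauchy–Schwarz
    set K : ℝ := |C₂| with hK
    have hvum : ∀ n, AEStronglyMeasurable (uncurry fun t x => v n t x - u t x) μ := fun n =>
      (hsol n).aestronglyMeasurable_uncurry_velocity.sub hum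
    have hJbound : ∀ n, ∫⁻ t in Ioo 0 T, (∫⁻ x, ‖v n t x - u t x‖ₑ ^ 2) ^ (1 / 2 : ℝ) < ⊤ →
        ‖∫ p, θ n p.1 p.2 * H n p.1 p.2 ∂μ‖ ≤
        (ENNReal.ofReal K * ((∫⁻ t in Ioo 0 T, (∫⁻ x, ‖v n t x - u t x‖ₑ ^ 2) ^ (1 / 2 : ℝ)) *
          (C : ℝ≥0∞) ^ (1 / 2 : ℝ))).toReal := by
      intro n hfin
      have h1 : ‖∫ p, θ n p.1 p.2 * H n p.1 p.2 ∂μ‖ ≤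
          (∫⁻ p, ‖θ n p.1 p.2 * H n p.1 p.2‖ₑ ∂μ).toReal := by
        rw [← integral_norm_eq_lintegral_enorm (hθH n).1]
        exact norm_integral_le_integral_norm _
      refine h1.trans (ENNReal.toReal_mono (ENNReal.mul_ne_top ENNReal.ofReal_ne_top
        (ENNReal.mul_ne_top hfin.ne hC12)) ?_)
      have h2 : ∫⁻ p, ‖θ n p.1 p.2 * H n p.1 p.2‖ₑ ∂μ ≤
          ∫⁻ p, ENNReal.ofReal K * (‖v n p.1 p.2 - u p.1 p.2‖ₑ * ‖θ n p.1 p.2‖ₑ) ∂μ := by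
        refine lintegral_mono_ae ?_
        have hae : ∀ᵐ p ∂μ, p.1 ∈ Ioo 0 T :=
          (Measure.quasiMeasurePreserving_fst (μ := (volume : Measure ℝ).restrict (Ioo 0 T))
            (ν := (volume : Measure (UnitAddTorus d)))).ae (ae_restrict_mem measurableSet_Ioo)
        filter_upwards [hae] with p hp
        have hp' : p.1 ∈ Icc 0 T := Ioo_subset_Icc_self hp
        have hin : ‖H n p.1 p.2‖ₑ ≤ ‖v n p.1 p.2 - u p.1 p.2‖ₑ * ENNReal.ofReal K := by
          rw [hH, ← ofReal_norm, ← ofReal_norm, ← ENNReal.ofReal_mul (norm_nonneg _)]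
          refine ENNReal.ofReal_le_ofReal ?_
          exact (norm_inner_le_norm _ _).trans (mul_le_mul_of_nonneg_left
            ((hC₂ p.1 hp' p.2).trans (le_abs_self _)) (norm_nonneg _))
        rw [enorm_mul]
        calc ‖θ n p.1 p.2‖ₑ * ‖H n p.1 p.2‖ₑ
            ≤ ‖θ n p.1 p.2‖ₑ * (‖v n p.1 p.2 - u p.1 p.2‖ₑ * ENNReal.ofReal K) := by gcongr
          _ = ENNReal.ofReal K * (‖v n p.1 p.2 - u p.1 p.2‖ₑ * ‖θ n p.1 p.2‖ₑ) := by ring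
      refine h2.trans ?_
      rw [lintegral_const_mul' _ _ ENNReal.ofReal_ne_top]
      gcongr
      have hmeas : AEMeasurable (fun p : ℝ × UnitAddTorus d => ‖v n p.1 p.2 - u p.1 p.2‖ₑ * ‖θ n p.1 p.2‖ₑ) μ :=
        (hvum n).enorm.mul (hsol n).aestronglyMeasurable_uncurry.enorm
      have e : ∫⁻ p, ‖v n p.1 p.2 - u p.1 p.2‖ₑ * ‖θ n p.1 p.2‖ₑ ∂μ =
          ∫⁻ t in Ioo 0 T, ∫⁻ x, ‖v n t x - u t x‖ₑ * ‖θ n t x‖ₑ := lintegral_prod _ hmeas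
      rw [e]
      exact lintegral_lintegral_enorm_mul_le_of_sq_le (hvum n) (hsol n).aestronglyMeasurable_uncurry (hbd n)
    have hJ : Tendsto (fun n => ∫ p, θ n p.1 p.2 * H n p.1 p.2 ∂μ) atTop (𝓝 0) := by
      have hlim0 : Tendsto (fun n => (ENNReal.ofReal K *
          ((∫⁻ t in Ioo 0 T, (∫⁻ x, ‖v n t x - u t x‖ₑ ^ 2) ^ (1 / 2 : ℝ)) *
            (C : ℝ≥0∞) ^ (1 / 2 : ℝ))).toReal) atTop (𝓝 0) := by
        have h1 := ENNReal.Tendsto.mul_const hv (Or.inr hC12) (b := (C : ℝ≥0∞) ^ (1 / 2 : ℝ))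
        rw [zero_mul] at h1
        have h2 := ENNReal.Tendsto.const_mul h1 (Or.inr ENNReal.ofReal_ne_top) (a := ENNReal.ofReal K)
        rw [mul_zero] at h2
        have h3 := (ENNReal.tendsto_toReal ENNReal.zero_ne_top).comp h2
        rwa [ENNReal.toReal_zero] at h3
      have hev : ∀ᶠ n in atTop, ∫⁻ t in Ioo 0 T, (∫⁻ x, ‖v n t x - u t x‖ₑ ^ 2) ^ (1 / 2 : ℝ) < ⊤ :=
        (tendsto_order.1 hv).2 ⊤ ENNReal.zero_lt_top
      exact squeeze_zero_norm' (hev.mono fun n hn => hJbound n hn) hlim0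
    -- (d) the datum term `∫ gₙ ψ(0) → ∫ θ₀ ψ(0)`
    have hD : Tendsto (fun n => ∫ x, g n x * ψ 0 x) atTop (𝓝 (∫ x, θ₀ x * ψ 0 x)) := by
      have hψ0m : AEStronglyMeasurable (ψ 0) volume := hψ0c.aestronglyMeasurable
      have hI0 : Integrable (fun x => θ₀ x * ψ 0 x) volume :=
        (hθ₀.integrable one_le_two).mul_bdd hψ0m (Eventually.of_forall hψ0)
      have hIn : ∀ n, Integrable (fun x => g n x * ψ 0 x) volume := fun n =>
        ((hg n).integrable one_le_two).mul_bdd hψ0m (Eventually.of_forall hψ0)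
      have hbound : ∀ n, ‖(∫ x, g n x * ψ 0 x) - ∫ x, θ₀ x * ψ 0 x‖ ≤
          (ENNReal.ofReal C₀ * eLpNorm (g n - θ₀) 2 volume).toReal := by
        intro n
        rw [← integral_sub (hIn n) hI0]
        have hm : AEStronglyMeasurable (fun x => g n x * ψ 0 x - θ₀ x * ψ 0 x) volume :=
          ((hIn n).sub hI0).1
        have h1 : ‖∫ x, (g n x * ψ 0 x - θ₀ x * ψ 0 x)‖ ≤
            (∫⁻ x, ‖g n x * ψ 0 x - θ₀ x * ψ 0 x‖ₑ).toReal := by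
          rw [← integral_norm_eq_lintegral_enorm hm]
          exact norm_integral_le_integral_norm _
        refine h1.trans (ENNReal.toReal_mono
          (ENNReal.mul_ne_top ENNReal.ofReal_ne_top ((hg n).sub hθ₀).eLpNorm_ne_top) ?_)
        calc ∫⁻ x, ‖g n x * ψ 0 x - θ₀ x * ψ 0 x‖ₑ ≤ ∫⁻ x, ENNReal.ofReal C₀ * ‖(g n - θ₀) x‖ₑ := by
              refine lintegral_mono fun x => ?_
              rw [← sub_mul, enorm_mul, mul_comm, Pi.sub_apply]
              gcongr
              rw [← ofReal_norm]
              exact ENNReal.ofReal_le_ofReal (hψ0 x)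
          _ = ENNReal.ofReal C₀ * eLpNorm (g n - θ₀) 1 volume := by
              rw [lintegral_const_mul' _ _ ENNReal.ofReal_ne_top, eLpNorm_one_eq_lintegral_enorm]
          _ ≤ ENNReal.ofReal C₀ * eLpNorm (g n - θ₀) 2 volume := by
              gcongr
              exact eLpNorm_le_eLpNorm_of_exponent_le one_le_two ((hg n).sub hθ₀).1
      have hlim0 : Tendsto (fun n => (ENNReal.ofReal C₀ * eLpNorm (g n - θ₀) 2 volume).toReal) atTop
          (𝓝 0) := by
        have h := ENNReal.Tendsto.const_mul hgθ₀ (Or.inr ENNReal.ofReal_ne_top) (a := ENNReal.ofReal C₀)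
        rw [mul_zero] at h
        have h' := (ENNReal.tendsto_toReal ENNReal.zero_ne_top).comp h
        rwa [ENNReal.toReal_zero] at h'
      rw [tendsto_iff_norm_sub_tendsto_zero]
      exact squeeze_zero (fun n => norm_nonneg _) hbound hlim0
    -- (e) conclusion: `∫∫ W G = lim ∫∫ θₙ G = -lim (Jₙ + Dₙ) = -∫ θ₀ ψ(0)`
    have hA' : Tendsto (fun n => ∫ t in Ioo 0 T, ∫ x, θ n t x * G t x) atTop
        (𝓝 (-(0 : ℝ) - ∫ x, θ₀ x * ψ 0 x)) :=
      (hJ.neg.sub hD).congr fun n => (hident n).symm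
    rw [tendsto_nhds_unique hA hA']
    ring

end Limit

end Torus

/-! ## Bonicatto–Ciampa–Crippa 2024, Proposition 2.4 — DISCHARGED -/

/-- **Bonicatto–Ciampa–Crippa 2024, Proposition 2.4 holds** (existence of a parabolic solution of
`∂ₜθ + div(b θ) = Δθ` on `(0,T) × T^d` for a divergence-free drift `b ∈ L¹([0,T];L²(T^d))` and
`θ₀ ∈ L²(T^d)`). The source's proof («regularise `b` and `u₀`, energy balance (2.4), weak
compactness») run in the tree's vocabulary: the drift is truncated in time where
`‖b(t)‖_{L²} ≤ K` (a square-integrable divergence-free field, `b_K → b` in `L¹_t L²_x`), the datum is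
mollified (`Torus.exists_isSmooth_tendsto_eLpNorm_sub`: smooth, hence bounded, `‖hₙ‖₂ ≤ ‖θ₀‖₂`,
`hₙ → θ₀` in `L²`); along `b_K` with datum `h_K` the tree's existence theorem for `L²_{t,x}` drifts and
bounded data (`Torus.exists_isWeakScalarTransportOn_of_abs_le`, itself the regularisation scheme of
DiPerna–Lions 1989, Prop. II.1) provides weak solutions with `∫ |θ_K(t)|² ≤ ‖θ₀‖²_{L²}` and
`2 ∫₀ᵀ ‖∇θ_K‖² ≤ ‖θ₀‖²_{L²}` — the energy balance (2.4); a subsequence converges weak-* in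
`L^∞(0,T; L²)` (`FunctionSpaces.Torus.exists_strictMono_weakLimit_of_lintegral_sq_le`), the limit is a
weak solution along `b` (`Torus.IsWeakScalarTransportOn.of_tendsto_of_lintegral_sqrt_lt_top`) and lies
in `L²_t H¹_x` by weak lower semicontinuity of the dissipation
(`Torus.lintegral_eScalarGradNormSq_le_liminf_of_weakLimit`).
[cite: BonicattoCiampaCrippa2023, Prop. 2.4 (arXiv:2306.15529 §2, proof: regularisation, energy balance (2.4), weak compactness)] -/
theorem BonicattoCiampaCrippa2024_prop24_holds : BonicattoCiampaCrippa2024_prop24 := by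
  intro d _ T hT b θ₀ hbm hbL1 hdiv hθ₀
  classical
  set μT : Measure ℝ := (volume : Measure ℝ).restrict (Ioo 0 T) with hμT
  set μ : Measure (ℝ × UnitAddTorus d) := μT.prod (volume : Measure (UnitAddTorus d)) with hμ
  haveI : IsFiniteMeasure μT := isFiniteMeasure_restrict.2 measure_Ioo_lt_top.ne
  -- the drift in uncurried form, its `L¹_t L²_x` norm and a measurable slice norm
  have hbu : AEStronglyMeasurable (uncurry b) μ :=
    FunctionSpaces.Torus.aestronglyMeasurable_uncurry_of_stLift_prod hbm
  have hb1 : ∫⁻ t in Ioo 0 T, (∫⁻ x, ‖b t x‖ₑ ^ 2) ^ (1 / 2 : ℝ) < ⊤ := by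
    have e : ∫⁻ t in Ioo 0 T, (∫⁻ x, ‖b t x‖ₑ ^ 2) ^ (1 / 2 : ℝ) =
        ∫⁻ t in Ioo 0 T, eLpNorm (b t) 2 volume := by
      refine lintegral_congr fun t => ?_
      rw [FunctionSpaces.eLpNorm_two_eq_pow_two_rpow_half, FunctionSpaces.eLpNorm_two_pow_two_eq_lintegral]
    rw [e]
    exact hbL1
  have hN₀m : AEMeasurable (fun t => ∫⁻ x, ‖b t x‖ₑ ^ 2) μT := (hbu.enorm.pow_const 2).lintegral_prod_right'
  obtain ⟨N, hNm, hNN⟩ : ∃ N : ℝ → ℝ≥0∞, Measurable N ∧ ∀ᵐ t ∂μT, N t = ∫⁻ x, ‖b t x‖ₑ ^ 2 :=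
    ⟨hN₀m.mk _, hN₀m.measurable_mk, hN₀m.ae_eq_mk.mono fun t ht => ht.symm⟩
  have hNfin : ∫⁻ t, N t ^ (1 / 2 : ℝ) ∂μT < ⊤ := by
    have e : ∫⁻ t, N t ^ (1 / 2 : ℝ) ∂μT = ∫⁻ t, (∫⁻ x, ‖b t x‖ₑ ^ 2) ^ (1 / 2 : ℝ) ∂μT :=
      lintegral_congr_ae (hNN.mono fun t ht => by simp only [ht])
    rw [e]
    exact hb1
  -- the truncated drifts `b_K = 1_{‖b(t)‖² ≤ K²} b`
  set bK : ℕ → ℝ → UnitAddTorus d → EuclideanSpace ℝ d := fun K t x =>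
    if N t ≤ (K : ℝ≥0∞) ^ 2 then b t x else 0 with hbK
  have hbKu : ∀ K, AEStronglyMeasurable (uncurry (bK K)) μ := fun K =>
    Torus.aestronglyMeasurable_uncurry_timeTrunc hbu hNm K
  have hbKst : ∀ K, AEStronglyMeasurable (FunctionSpaces.Torus.stLift (bK K))
      (volume.restrict (Ioo 0 T ×ˢ univ)) := fun K =>
    FunctionSpaces.Torus.aestronglyMeasurable_stLift_of_uncurry (hbKu K)
  have hbK2 : ∀ K, ∫⁻ t in Ioo 0 T, ∫⁻ x, ‖bK K t x‖ₑ ^ 2 < ⊤ := fun K =>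
    lt_of_le_of_lt (Torus.lintegral_lintegral_sq_timeTrunc_le hNN K)
      (ENNReal.mul_lt_top (ENNReal.pow_lt_top ENNReal.coe_lt_top) measure_Ioo_lt_top)
  have hbKdiv : ∀ K, ∀ᵐ t ∂μT, FunctionSpaces.Torus.IsWeaklyDivFree (bK K t) := by
    intro K
    filter_upwards [hdiv] with t ht
    by_cases hK : N t ≤ (K : ℝ≥0∞) ^ 2
    · have e : bK K t = b t := by
        funext x
        simp [hbK, hK]
      rw [e]
      exact ht
    · have e : bK K t = 0 := by
        funext x
        simp [hbK, hK]
      rw [e]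
      exact fun φ _ => by simp
  have hbKlim : Tendsto (fun K => ∫⁻ t in Ioo 0 T, (∫⁻ x, ‖bK K t x - b t x‖ₑ ^ 2) ^ (1 / 2 : ℝ))
      atTop (𝓝 0) := by
    have e : (fun K => ∫⁻ t in Ioo 0 T, (∫⁻ x, ‖bK K t x - b t x‖ₑ ^ 2) ^ (1 / 2 : ℝ)) =
        fun K : ℕ => ∫⁻ t in {t | (K : ℝ≥0∞) ^ 2 < N t}, N t ^ (1 / 2 : ℝ) ∂μT :=
      funext fun K => Torus.lintegral_sqrt_timeTrunc_sub_eq hNm hNN K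
    rw [e]
    exact Torus.tendsto_setLIntegral_sqrt_gt_sq hNm hNfin
  -- the regularised data
  obtain ⟨h, hh, hhle, hhlim⟩ := Torus.exists_isSmooth_tendsto_eLpNorm_sub hθ₀
  have hh2 : ∀ n, MemLp (h n) 2 volume := fun n => (hh n).memLp 2
  have hhbd : ∀ n, ∃ H : ℝ, ∀ᵐ x ∂(volume : Measure (UnitAddTorus d)), |h n x| ≤ H := by
    intro n
    obtain ⟨H, hH⟩ := isCompact_univ.exists_bound_of_continuousOn (hh n).continuous.continuousOn
    exact ⟨H, Eventually.of_forall fun x => by rw [← Real.norm_eq_abs]; exact hH x (mem_univ x)⟩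
  -- Stage 1: weak solutions along the truncated drifts with the regularised data
  have hS1 : ∀ n, ∃ θ : ℝ → UnitAddTorus d → ℝ, Torus.IsWeakScalarTransportOn T 1 (bK n) (h n) θ ∧
      (∀ᵐ t ∂μT, ∫⁻ x, ‖θ t x‖ₑ ^ 2 ≤ eLpNorm (h n) 2 volume ^ 2) ∧
      2 * Torus.eScalarDissipation 1 θ 0 T ≤ ∫⁻ x, ‖h n x‖ₑ ^ 2 := by
    intro n
    obtain ⟨H, hH⟩ := hhbd n
    obtain ⟨θ, hθ, hθb, -, hθd⟩ := Torus.exists_isWeakScalarTransportOn_of_abs_le one_pos hT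
      (hh n).continuous.aestronglyMeasurable hH (hbKst n) (hbK2 n) (hbKdiv n)
    exact ⟨θ, hθ, hθb, hθd⟩
  choose θ hsol hθb hθd using hS1
  -- uniform bounds, `C = ‖θ₀‖²_{L²}`
  set C : ℝ≥0 := (eLpNorm θ₀ 2 volume ^ 2).toNNReal with hC
  have hCeq : (C : ℝ≥0∞) = eLpNorm θ₀ 2 volume ^ 2 :=
    ENNReal.coe_toNNReal (ENNReal.pow_ne_top hθ₀.eLpNorm_ne_top)
  have hhC : ∀ n, eLpNorm (h n) 2 volume ^ 2 ≤ C := fun n => by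
    rw [hCeq]
    exact pow_le_pow_left' (hhle n) 2
  have hbd : ∀ n, ∀ᵐ t ∂μT, ∫⁻ x, ‖θ n t x‖ₑ ^ 2 ≤ C := fun n =>
    (hθb n).mono fun t ht => ht.trans (hhC n)
  have hdis : ∀ n, ∫⁻ t in Ioo 0 T, Torus.eScalarGradNormSq (θ n t) ≤ C := by
    intro n
    have h1 := hθd n
    have h2 : ∫⁻ x, ‖h n x‖ₑ ^ 2 ≤ C := by
      rw [← FunctionSpaces.eLpNorm_two_pow_two_eq_lintegral]
      exact hhC n
    rw [Torus.eScalarDissipation, ENNReal.ofReal_one, one_mul] at h1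
    calc ∫⁻ t in Ioo 0 T, Torus.eScalarGradNormSq (θ n t)
        ≤ 2 * ∫⁻ t in Ioo 0 T, Torus.eScalarGradNormSq (θ n t) := le_mul_of_one_le_left zero_le one_le_two
      _ ≤ C := h1.trans h2
  -- Stage 2: weak-* extraction, identification of the limit, lower semicontinuity
  obtain ⟨φ, hφ, W, hWm, hWb, hWlim⟩ :=
    FunctionSpaces.Torus.exists_strictMono_weakLimit_of_lintegral_sq_le
      (fun n => (hsol n).aestronglyMeasurable) hbd
  have hW : Torus.IsWeakScalarTransportOn T 1 b θ₀ W :=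
    Torus.IsWeakScalarTransportOn.of_tendsto_of_lintegral_sqrt_lt_top (fun j => hsol (φ j))
      (fun j => hbd (φ j)) hWm hWb hWlim hbm hb1 hdiv (hbKlim.comp hφ.tendsto_atTop) hθ₀
      (fun j => hh2 (φ j)) (hhlim.comp hφ.tendsto_atTop)
  refine ⟨W, hW, ?_⟩
  have hlsc := Torus.lintegral_eScalarGradNormSq_le_liminf_of_weakLimit
    (fun j => (hsol (φ j)).aestronglyMeasurable) (fun j => hbd (φ j)) hWm hWb hWlim
  calc ∫⁻ t in Ioo 0 T, Torus.eScalarGradNormSq (W t)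
      ≤ liminf (fun j => ∫⁻ t in Ioo 0 T, Torus.eScalarGradNormSq (θ (φ j) t)) atTop := hlsc
    _ ≤ C := liminf_le_of_frequently_le (Eventually.of_forall fun j => hdis (φ j)).frequently
    _ < ⊤ := ENNReal.coe_lt_top

end Literature.Analysis.FluidPDE

end
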